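import Mathlib

/-!
# The four-atom sandwich lemma (blind cell PercRepro2, night-2 g16; proofs/NIGHT2-DARC.md §56.14)

Push the cleared functional of row 2′DARC forward along the two markers: the core levels fall into
the four atoms `∅, 1, 2, 12` (`x = 1` on `1, 12`, `y = 1` on `2, 12`), the `R`-law into
`r₀, r₁, r₂, r₁₂` and the gate into `g₀, g₁, g₂, g₁₂` (sums over the fibres; both stay
log-supermodular by the four functions theorem).  With `A = r₁ + r₁₂`, `B = r₂ + r₁₂`,
`Λ = r₀ + r₁ + r₂ + r₁₂` the functional is
`T = g₀·A·B − g₁·(Λ − A)·B − g₂·A·(Λ − B) + g₁₂·(Λ − A)·(Λ − B)`, and the IDENTITY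
`g₀·T = [g₀A − g₁(Λ − A)]·[g₀B − g₂(Λ − B)] + (g₀g₁₂ − g₁g₂)·(Λ − A)·(Λ − B)`
proves `T ≥ 0` from the log-supermodularity of the gate (`g₁g₂ ≤ g₀g₁₂`) and the two ODDS
conditions `g₁(Λ − A) ≤ g₀A`, `g₂(Λ − B) ≤ g₀B` — «the gate's mean of one marker on the clusters
missing the other is at most the `R`-mean of that marker» (`fourAtom_sandwich_of_odds`).  When
the gate equals the `R`-law on the bottom atom and is dominated by it on the two middle atoms
(`g₀ = r₀`, `g₁ ≤ r₁`, `g₂ ≤ r₂`) the odds conditions follow from the log-supermodularity of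
the `R`-law (`fourAtom_sandwich`): this is the LSM SANDWICH of §56.14 for two markers on a
two-element core, the seed of the conjectured general statement.  Mathlib only.
-/

namespace Summit.Ventures.PercRepro2.Coin

section FourAtom

variable {R : Type*} [Field R] [LinearOrder R] [IsStrictOrderedRing R]

/-- The cleared four-atom functional. -/
def fourAtomT (r₀ r₁ r₂ r₁₂ g₀ g₁ g₂ g₁₂ : R) : R :=
  (r₀ + r₁ + r₂ + r₁₂) ^ 2 * g₁₂
    - (r₀ + r₁ + r₂ + r₁₂) * (r₁ + r₁₂) * (g₂ + g₁₂)
    - (r₀ + r₁ + r₂ + r₁₂) * (r₂ + r₁₂) * (g₁ + g₁₂)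
    + (r₁ + r₁₂) * (r₂ + r₁₂) * (g₀ + g₁ + g₂ + g₁₂)

omit [LinearOrder R] [IsStrictOrderedRing R] in
/-- The identity `g₀·T = [g₀A − g₁(Λ−A)]·[g₀B − g₂(Λ−B)] + (g₀g₁₂ − g₁g₂)·(Λ−A)·(Λ−B)`. -/
lemma fourAtomT_identity (r₀ r₁ r₂ r₁₂ g₀ g₁ g₂ g₁₂ : R) :
    g₀ * fourAtomT r₀ r₁ r₂ r₁₂ g₀ g₁ g₂ g₁₂ =
      (g₀ * (r₁ + r₁₂) - g₁ * (r₀ + r₂)) * (g₀ * (r₂ + r₁₂) - g₂ * (r₀ + r₁))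
        + (g₀ * g₁₂ - g₁ * g₂) * (r₀ + r₂) * (r₀ + r₁) := by
  unfold fourAtomT; ring

/-- **The four-atom sandwich from the odds conditions**: the gate log-supermodular on the four
atoms, `g₁(Λ − A) ≤ g₀A` and `g₂(Λ − B) ≤ g₀B` ⟹ `T ≥ 0`. -/
theorem fourAtom_sandwich_of_odds (r₀ r₁ r₂ r₁₂ g₀ g₁ g₂ g₁₂ : R)
    (hr₀ : 0 ≤ r₀) (hr₁ : 0 ≤ r₁) (hr₂ : 0 ≤ r₂)
    (hg₀ : 0 ≤ g₀) (hg₁ : 0 ≤ g₁) (hg₂ : 0 ≤ g₂) (hg₁₂ : 0 ≤ g₁₂)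
    (hg : g₁ * g₂ ≤ g₀ * g₁₂)
    (hodd₁ : g₁ * (r₀ + r₂) ≤ g₀ * (r₁ + r₁₂)) (hodd₂ : g₂ * (r₀ + r₁) ≤ g₀ * (r₂ + r₁₂)) :
    0 ≤ fourAtomT r₀ r₁ r₂ r₁₂ g₀ g₁ g₂ g₁₂ := by
  have hid := fourAtomT_identity r₀ r₁ r₂ r₁₂ g₀ g₁ g₂ g₁₂
  have hprod : 0 ≤ (g₀ * (r₁ + r₁₂) - g₁ * (r₀ + r₂)) * (g₀ * (r₂ + r₁₂) - g₂ * (r₀ + r₁)) :=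
    mul_nonneg (by linarith) (by linarith)
  have hlsm : 0 ≤ (g₀ * g₁₂ - g₁ * g₂) * (r₀ + r₂) * (r₀ + r₁) :=
    mul_nonneg (mul_nonneg (by linarith) (by linarith)) (by linarith)
  rcases eq_or_lt_of_le hg₀ with h0 | h0
  · -- g₀ = 0: the odds conditions kill the two negative terms
    rw [← h0] at hodd₁ hodd₂
    simp only [zero_mul] at hodd₁ hodd₂
    have e1 : g₁ * (r₀ + r₂) = 0 := le_antisymm hodd₁ (mul_nonneg hg₁ (by linarith))
    have e2 : g₂ * (r₀ + r₁) = 0 := le_antisymm hodd₂ (mul_nonneg hg₂ (by linarith))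
    have hT : fourAtomT r₀ r₁ r₂ r₁₂ g₀ g₁ g₂ g₁₂ =
        g₀ * (r₁ + r₁₂) * (r₂ + r₁₂) - (r₂ + r₁₂) * (g₁ * (r₀ + r₂))
          - (r₁ + r₁₂) * (g₂ * (r₀ + r₁)) + g₁₂ * (r₀ + r₂) * (r₀ + r₁) := by
      unfold fourAtomT; ring
    rw [hT, e1, e2, ← h0]
    have : 0 ≤ g₁₂ * (r₀ + r₂) * (r₀ + r₁) :=
      mul_nonneg (mul_nonneg hg₁₂ (by linarith)) (by linarith)
    linarith
  · -- g₀ > 0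
    have : 0 ≤ g₀ * fourAtomT r₀ r₁ r₂ r₁₂ g₀ g₁ g₂ g₁₂ := by rw [hid]; linarith
    exact nonneg_of_mul_nonneg_right (by linarith [this]) h0

/-- **The four-atom LSM sandwich**: `R`-law and gate both log-supermodular on the four atoms,
`g₀ = r₀`, `g₁ ≤ r₁`, `g₂ ≤ r₂` ⟹ `T ≥ 0`. -/
theorem fourAtom_sandwich (r₀ r₁ r₂ r₁₂ g₀ g₁ g₂ g₁₂ : R)
    (hr₀ : 0 ≤ r₀) (hr₁ : 0 ≤ r₁) (hr₂ : 0 ≤ r₂)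
    (hg₀ : 0 ≤ g₀) (hg₁ : 0 ≤ g₁) (hg₂ : 0 ≤ g₂) (hg₁₂ : 0 ≤ g₁₂)
    (hr : r₁ * r₂ ≤ r₀ * r₁₂) (hg : g₁ * g₂ ≤ g₀ * g₁₂)
    (h0 : g₀ = r₀) (h1 : g₁ ≤ r₁) (h2 : g₂ ≤ r₂) :
    0 ≤ fourAtomT r₀ r₁ r₂ r₁₂ g₀ g₁ g₂ g₁₂ := by
  apply fourAtom_sandwich_of_odds r₀ r₁ r₂ r₁₂ g₀ g₁ g₂ g₁₂ hr₀ hr₁ hr₂ hg₀ hg₁ hg₂ hg₁₂ hg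
  · -- g₁ (r₀ + r₂) ≤ r₁ (r₀ + r₂) = r₀ r₁ + r₁ r₂ ≤ r₀ r₁ + r₀ r₁₂ = g₀ (r₁ + r₁₂)
    rw [h0]
    have := mul_le_mul_of_nonneg_right h1 (by linarith : (0 : R) ≤ r₀ + r₂)
    nlinarith
  · rw [h0]
    have := mul_le_mul_of_nonneg_right h2 (by linarith : (0 : R) ≤ r₀ + r₁)
    nlinarith

end FourAtom

end Summit.Ventures.PercRepro2.Coin
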